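import Summits.QuantumFields.YangMills.Theorems.ParabolicTrajectoryTunedSequenceExistsPairCeilingCore

/-!
# `TunedSequenceExists` (stmt-QuantumFields-10524), line `fixed-aspect-window`: the last mile, part 2 —
# mirror stubs (A_in)/(A_out) from a plaquette-pair ceiling; their FEMTO part from stmt-QuantumFields-16204

Sequel of `…PairCeilingCore.lean` (`PairCeilingAt r β L C`: `|cov_{β,2L+1}(P x i j, P y i' j')|·dist(x,y)⁸ ≤ C`
for torus plaquette deficits).  Seat c4 (lead), `--supports stmt-QuantumFields-10524`.  Proved here:
* `pow_mul_abs_mirrorIn_le`, `pow_mul_abs_mirrorOut_le` — at fixed `(β, L)`, `2 ≤ D ≤ L`: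
  `D⁸ |⟨P ; τ_D Pᴿ⟩_{β,2L+1}|, D⁸ |⟨Pᴿ ; τ_D P⟩_{β,2L+1}| ≤ 36·2⁸·C` (36 on-axis plaquette pairs at distances
  `D`, `D ± 1`; for the outward pair at `D = L` the distance `D + 1` is read as `L` through the back of the torus);
* `mirrorBoundIn_of_pairCeiling`, `mirrorBoundOut_of_pairCeiling` — an all-VOLUME pair ceiling at weak coupling
  (`β ≥ β₁`, all `L`, one `C`) gives the registered stubs `FixedAspectSplit.MirrorBoundIn/Out r`;
* `mirrorBounds_femto_of_cruxCAt`, `mirrorBounds_femto_of_femtoCurvatureTwoPointC` — the FEMTO part of both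
  stubs (`β ≥ β₁`, all `L` with `(2L+1)·a(β) ≤ ℓ₀`, all `D ≤ L`) follows from the sibling crux
  `Theses.LangevinControlUV.FemtoCurvatureTwoPointC` (stmt-QuantumFields-16204); so the NEW content of
  (A_in)/(A_out) is the same ceiling on tori larger than the femto window (crossover + infrared).
References: Osterwalder–Seiler 1978 §2; Bałaban CMP 122-II p. 356.
-/

noncomputable section

open MeasureTheory ProbabilityTheory Finset Filter Topology
open Literature.MathematicalPhysics.QuantumFieldTheory hiding Site ZdEdge
open Literature.MathematicalPhysics.QuantumLattice
open Literature.Probability.LatticeModels hiding configShift configShift_apply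
open Summit.QuantumFields.YangMills.Theorems.FiniteSusceptibilityWeakCoupling
open Summit.QuantumFields.YangMills.Theorems.FiniteSusceptibilityWeakCoupling.MirrorDominationAxis0

namespace Summit.QuantumFields.YangMills.Theorems.TunedSequenceExists.PairCeiling

variable {G : Type} [Group G] [TopologicalSpace G] [IsTopologicalGroup G] [CompactSpace G]
  [MeasurableSpace G] [BorelSpace G]

/-! ## The two mirror correlators at fixed `(β, L)` under the pair ceiling -/

section Mirror

variable (r : LatticeRep G) {β C : ℝ} {L : ℕ}

/-- The corner density on the lift itself (no translation), as a sum of torus plaquette functions at `π 0`.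
[folklore] -/
theorem curvature_torusLift_eq_sum (L' : ℕ) (U : GaugeConfig 4 L' G) :
    r.curvature.F (torusLift L' U) =
      ∑ q : {q : Fin 4 × Fin 4 // q.1 < q.2},
        (r.ρ (plaquetteHolonomy U (Torus.proj L' (Pi.single 0 (0 : ℤ))) q.1.1 q.1.2)).trace.re := by
  rw [Pi.single_zero, ← curvature_shift_torusLift_eq_sum r L' 0 U, neg_zero, configShift_zero]

/-- The mirror corner density on the lift itself: magnetic plaquettes at `π 0`, electric ones at `π(−e₀)`.
[cite: OsterwalderSeiler1978, §2] -/
theorem mirror_torusLift_eq_sum (L' : ℕ) (U : GaugeConfig 4 L' G) :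
    r.curvature.F (cfgReflect (torusLift L' U)) =
      ∑ q : {q : Fin 4 × Fin 4 // q.1 < q.2},
        (r.ρ (plaquetteHolonomy U
          (Torus.proj L' (Pi.single 0 (if q.1.1 = 0 then (-1 : ℤ) else 0))) q.1.1 q.1.2)).trace.re := by
  have h := mirror_shift_torusLift_eq_sum r L' 0 U
  rw [neg_zero, configShift_zero] at h
  rw [h]
  refine Finset.sum_congr rfl fun q _ => ?_
  by_cases hq : q.1.1 = 0
  · simp only [hq, ↓reduceIte, zero_sub]
    rw [← Pi.single_neg]
  · simp only [hq, ↓reduceIte, Pi.single_zero]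

/-- The mirror corner density on the translate `τ_D` of the lift: magnetic plaquettes at `π(D e₀)`, electric
ones at `π((D−1) e₀)`. [cite: OsterwalderSeiler1978, §2] -/
theorem mirror_shift_torusLift_eq_sum' (L' : ℕ) (D : ℕ) (U : GaugeConfig 4 L' G) :
    r.curvature.F (cfgReflect (configShift (-(Pi.single 0 (D : ℤ))) (torusLift L' U))) =
      ∑ q : {q : Fin 4 × Fin 4 // q.1 < q.2},
        (r.ρ (plaquetteHolonomy U
          (Torus.proj L' (Pi.single 0 (if q.1.1 = 0 then (D : ℤ) - 1 else D))) q.1.1 q.1.2)).trace.re := by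
  rw [mirror_shift_torusLift_eq_sum]
  refine Finset.sum_congr rfl fun q _ => ?_
  by_cases hq : q.1.1 = 0
  · simp only [hq, ↓reduceIte]
    rw [← Pi.single_sub]
  · simp only [hq, ↓reduceIte]

/-- **The inward mirror correlator under the pair ceiling.** For `2 ≤ D ≤ L`:
`D⁸ |⟨P ; τ_D Pᴿ⟩_{β,2L+1}| ≤ 36·2⁸·C` (36 on-axis plaquette pairs at distances `D`, `D − 1`).
[cite: OsterwalderSeiler1978, §2] -/
theorem pow_mul_abs_mirrorIn_le (hC : PairCeilingAt r β L C) {D : ℕ} (h2 : 2 ≤ D) (hD : D ≤ L) :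
    (D : ℝ) ^ 8 * |latticeConnectedCorr r.ρ β (2 * L + 1) r.curvature.F
      (fun V => r.curvature.F (cfgReflect V)) D| ≤ 36 * 2 ^ 8 * C := by
  have hC0 : 0 ≤ C := pairCeiling_nonneg r hC (by omega)
  have hcorr : latticeConnectedCorr r.ρ β (2 * L + 1) r.curvature.F
      (fun V => r.curvature.F (cfgReflect V)) D =
      cov[fun U => r.curvature.F (torusLift (2 * L + 1) U),
        fun U => (reflSpecies r.curvature).F
          (configShift (-(Pi.single 0 (D : ℤ))) (torusLift (2 * L + 1) U));
        wilsonMeasure (d := 4) (L := 2 * L + 1) r.ρ β] :=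
    (SiblingFunnel.covariance_eq_latticeConnectedCorr r β r.curvature (reflSpecies r.curvature) L D).symm
  rw [hcorr]
  -- the 36-term expansion
  have hfst : (fun U : GaugeConfig 4 (2 * L + 1) G => r.curvature.F (torusLift (2 * L + 1) U)) =
      fun U => ∑ q : {q : Fin 4 × Fin 4 // q.1 < q.2},
        (r.ρ (plaquetteHolonomy U (Torus.proj (2 * L + 1)
          ((fun _ : {q : Fin 4 × Fin 4 // q.1 < q.2} => (Pi.single 0 (0 : ℤ) : Site 4)) q))
          q.1.1 q.1.2)).trace.re := by
    funext U; exact curvature_torusLift_eq_sum r _ U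
  have hsnd : (fun U : GaugeConfig 4 (2 * L + 1) G => (reflSpecies r.curvature).F
        (configShift (-(Pi.single 0 (D : ℤ))) (torusLift (2 * L + 1) U))) =
      fun U => ∑ q : {q : Fin 4 × Fin 4 // q.1 < q.2},
        (r.ρ (plaquetteHolonomy U (Torus.proj (2 * L + 1)
          ((fun q : {q : Fin 4 × Fin 4 // q.1 < q.2} =>
            (Pi.single 0 (if q.1.1 = 0 then (D : ℤ) - 1 else D) : Site 4)) q)) q.1.1 q.1.2)).trace.re := by
    funext U; exact mirror_shift_torusLift_eq_sum' r _ D U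
  rw [hfst, hsnd]
  have hterm : ∀ q q' : {q : Fin 4 × Fin 4 // q.1 < q.2},
      |cov[fun U : GaugeConfig 4 (2 * L + 1) G =>
          (r.ρ (plaquetteHolonomy U (Torus.proj (2 * L + 1)
            ((fun _ : {q : Fin 4 × Fin 4 // q.1 < q.2} => (Pi.single 0 (0 : ℤ) : Site 4)) q))
            q.1.1 q.1.2)).trace.re,
        fun U => (r.ρ (plaquetteHolonomy U (Torus.proj (2 * L + 1)
          ((fun q : {q : Fin 4 × Fin 4 // q.1 < q.2} =>
            (Pi.single 0 (if q.1.1 = 0 then (D : ℤ) - 1 else D) : Site 4)) q')) q'.1.1 q'.1.2)).trace.re;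
        wilsonMeasure (d := 4) (L := 2 * L + 1) r.ρ β]| ≤ C / ((D : ℝ) - 1) ^ 8 := by
    intro q q'
    have hq : q.1.1 ≠ q.1.2 := fun h => by have := q.2; rw [h] at this; exact lt_irrefl _ this
    have hq' : q'.1.1 ≠ q'.1.2 := fun h => by have := q'.2; rw [h] at this; exact lt_irrefl _ this
    by_cases he : q'.1.1 = 0
    · simp only [if_pos he]
      refine (abs_cov_axis_le r hC (a := 0) (b := (D : ℤ) - 1) (m := -((D : ℤ) - 1))
        (by congr 1; ring) ?_ ?_ hq hq').trans (div_abs_pow_le hC0 h2 ?_)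
      · rw [abs_neg, abs_of_nonneg (by omega)]; omega
      · rw [abs_neg, abs_of_nonneg (by omega)]; omega
      · rw [abs_neg, abs_of_nonneg (by omega)]
    · simp only [if_neg he]
      refine (abs_cov_axis_le r hC (a := 0) (b := (D : ℤ)) (m := -(D : ℤ))
        (by congr 1; ring) ?_ ?_ hq hq').trans (div_abs_pow_le hC0 h2 ?_)
      · rw [abs_neg, abs_of_nonneg (by omega)]; omega
      · rw [abs_neg, abs_of_nonneg (by omega)]; omega
      · rw [abs_neg, abs_of_nonneg (by omega)]; omega
  have hsum := abs_cov_sum_sum_le r β L _ _ hterm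
  have h2' : (2 : ℝ) ≤ D := by exact_mod_cast h2
  have hD1 : (0 : ℝ) < (D : ℝ) - 1 := by linarith
  have hratio : (D : ℝ) ^ 8 ≤ 2 ^ 8 * ((D : ℝ) - 1) ^ 8 := by
    rw [← mul_pow]
    exact pow_le_pow_left₀ (by positivity) (by linarith) 8
  calc (D : ℝ) ^ 8 * |cov[_, _; wilsonMeasure (d := 4) (L := 2 * L + 1) r.ρ β]|
      ≤ (2 ^ 8 * ((D : ℝ) - 1) ^ 8) * (36 * (C / ((D : ℝ) - 1) ^ 8)) :=
        mul_le_mul hratio hsum (abs_nonneg _) (by positivity)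
    _ = 36 * 2 ^ 8 * C * (((D : ℝ) - 1) ^ 8 / ((D : ℝ) - 1) ^ 8) := by ring
    _ = 36 * 2 ^ 8 * C := by rw [div_self (pow_ne_zero 8 hD1.ne'), mul_one]

/-- **The outward mirror correlator under the pair ceiling.** For `2 ≤ D ≤ L`:
`D⁸ |⟨Pᴿ ; τ_D P⟩_{β,2L+1}| ≤ 36·2⁸·C` (36 on-axis plaquette pairs at distances `D`, `D + 1` — the latter read
as `L` through the back of the torus when `D = L`). [cite: OsterwalderSeiler1978, §2] -/
theorem pow_mul_abs_mirrorOut_le (hC : PairCeilingAt r β L C) {D : ℕ} (h2 : 2 ≤ D) (hD : D ≤ L) :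
    (D : ℝ) ^ 8 * |latticeConnectedCorr r.ρ β (2 * L + 1) (fun V => r.curvature.F (cfgReflect V))
      r.curvature.F D| ≤ 36 * 2 ^ 8 * C := by
  have hC0 : 0 ≤ C := pairCeiling_nonneg r hC (by omega)
  have hcorr : latticeConnectedCorr r.ρ β (2 * L + 1) (fun V => r.curvature.F (cfgReflect V))
      r.curvature.F D =
      cov[fun U => (reflSpecies r.curvature).F (torusLift (2 * L + 1) U),
        fun U => r.curvature.F (configShift (-(Pi.single 0 (D : ℤ))) (torusLift (2 * L + 1) U));
        wilsonMeasure (d := 4) (L := 2 * L + 1) r.ρ β] :=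
    (SiblingFunnel.covariance_eq_latticeConnectedCorr r β (reflSpecies r.curvature) r.curvature L D).symm
  rw [hcorr]
  have hfst : (fun U : GaugeConfig 4 (2 * L + 1) G => (reflSpecies r.curvature).F (torusLift (2 * L + 1) U)) =
      fun U => ∑ q : {q : Fin 4 × Fin 4 // q.1 < q.2},
        (r.ρ (plaquetteHolonomy U (Torus.proj (2 * L + 1)
          ((fun q : {q : Fin 4 × Fin 4 // q.1 < q.2} =>
            (Pi.single 0 (if q.1.1 = 0 then (-1 : ℤ) else 0) : Site 4)) q)) q.1.1 q.1.2)).trace.re := by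
    funext U; exact mirror_torusLift_eq_sum r _ U
  have hsnd : (fun U : GaugeConfig 4 (2 * L + 1) G =>
        r.curvature.F (configShift (-(Pi.single 0 (D : ℤ))) (torusLift (2 * L + 1) U))) =
      fun U => ∑ q : {q : Fin 4 × Fin 4 // q.1 < q.2},
        (r.ρ (plaquetteHolonomy U (Torus.proj (2 * L + 1)
          ((fun _ : {q : Fin 4 × Fin 4 // q.1 < q.2} => (Pi.single 0 (D : ℤ) : Site 4)) q))
          q.1.1 q.1.2)).trace.re := by
    funext U; exact curvature_shift_torusLift_eq_sum r _ _ U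
  rw [hfst, hsnd]
  have hterm : ∀ q q' : {q : Fin 4 × Fin 4 // q.1 < q.2},
      |cov[fun U : GaugeConfig 4 (2 * L + 1) G =>
          (r.ρ (plaquetteHolonomy U (Torus.proj (2 * L + 1)
            ((fun q : {q : Fin 4 × Fin 4 // q.1 < q.2} =>
              (Pi.single 0 (if q.1.1 = 0 then (-1 : ℤ) else 0) : Site 4)) q)) q.1.1 q.1.2)).trace.re,
        fun U => (r.ρ (plaquetteHolonomy U (Torus.proj (2 * L + 1)
          ((fun _ : {q : Fin 4 × Fin 4 // q.1 < q.2} => (Pi.single 0 (D : ℤ) : Site 4)) q'))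
          q'.1.1 q'.1.2)).trace.re;
        wilsonMeasure (d := 4) (L := 2 * L + 1) r.ρ β]| ≤ C / ((D : ℝ) - 1) ^ 8 := by
    intro q q'
    have hq : q.1.1 ≠ q.1.2 := fun h => by have := q.2; rw [h] at this; exact lt_irrefl _ this
    have hq' : q'.1.1 ≠ q'.1.2 := fun h => by have := q'.2; rw [h] at this; exact lt_irrefl _ this
    by_cases he : q.1.1 = 0
    · simp only [if_pos he]
      rcases hD.lt_or_eq with hlt | heq
      · -- `D < L`: distance `D + 1`
        refine (abs_cov_axis_le r hC (a := -1) (b := (D : ℤ)) (m := -((D : ℤ) + 1))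
          (by congr 1; ring) ?_ ?_ hq hq').trans (div_abs_pow_le hC0 h2 ?_)
        · rw [abs_neg, abs_of_nonneg (by omega)]; omega
        · rw [abs_neg, abs_of_nonneg (by omega)]; omega
        · rw [abs_neg, abs_of_nonneg (by omega)]; omega
      · -- `D = L`: through the back, `-1 - L ≡ L`, distance `L`
        subst heq
        have hm : (((-1 : ℤ) - (D : ℤ) : ℤ) : ZMod (2 * D + 1)) = ((D : ℤ) : ZMod (2 * D + 1)) := by
          rw [ZMod.intCast_eq_intCast_iff_dvd_sub]
          exact ⟨1, by push_cast; ring⟩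
        refine (abs_cov_axis_le r hC (a := -1) (b := (D : ℤ)) (m := (D : ℤ)) hm ?_ ?_ hq hq').trans
          (div_abs_pow_le hC0 h2 ?_)
        · rw [abs_of_nonneg (by omega)]; omega
        · rw [abs_of_nonneg (by omega)]
        · rw [abs_of_nonneg (by omega)]; omega
    · simp only [if_neg he]
      refine (abs_cov_axis_le r hC (a := 0) (b := (D : ℤ)) (m := -(D : ℤ))
        (by congr 1; ring) ?_ ?_ hq hq').trans (div_abs_pow_le hC0 h2 ?_)
      · rw [abs_neg, abs_of_nonneg (by omega)]; omega
      · rw [abs_neg, abs_of_nonneg (by omega)]; omega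
      · rw [abs_neg, abs_of_nonneg (by omega)]; omega
  have hsum := abs_cov_sum_sum_le r β L _ _ hterm
  have h2' : (2 : ℝ) ≤ D := by exact_mod_cast h2
  have hD1 : (0 : ℝ) < (D : ℝ) - 1 := by linarith
  have hratio : (D : ℝ) ^ 8 ≤ 2 ^ 8 * ((D : ℝ) - 1) ^ 8 := by
    rw [← mul_pow]
    exact pow_le_pow_left₀ (by positivity) (by linarith) 8
  calc (D : ℝ) ^ 8 * |cov[_, _; wilsonMeasure (d := 4) (L := 2 * L + 1) r.ρ β]|
      ≤ (2 ^ 8 * ((D : ℝ) - 1) ^ 8) * (36 * (C / ((D : ℝ) - 1) ^ 8)) :=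
        mul_le_mul hratio hsum (abs_nonneg _) (by positivity)
    _ = 36 * 2 ^ 8 * C * (((D : ℝ) - 1) ^ 8 / ((D : ℝ) - 1) ^ 8) := by ring
    _ = 36 * 2 ^ 8 * C := by rw [div_self (pow_ne_zero 8 hD1.ne'), mul_one]

end Mirror

/-! ## The stubs from an all-volume pair ceiling -/

section Stubs

variable (r : LatticeRep G)

/-- **(A_in) from an all-volume pair ceiling at weak coupling**: if for `β ≥ β₁` and ALL odd tori `2L+1` the
plaquette-pair ceiling holds with one constant `C`, then `FixedAspectSplit.MirrorBoundIn r` (the registered stub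
`stub_mirrorBoundIn`, with `K = max (2 C_P²) (36·2⁸·C)`). [cite: OsterwalderSeiler1978, §2] -/
theorem mirrorBoundIn_of_pairCeiling
    (h : ∃ (β₁ C : ℝ), ∀ (β : ℝ) (L : ℕ), β₁ ≤ β → PairCeilingAt r β L C) :
    FixedAspectSplit.MirrorBoundIn r := by
  obtain ⟨β₁, C, h⟩ := h
  obtain ⟨CP, hCP⟩ := r.curvature.bounded
  refine ⟨β₁, max (2 * (CP * CP)) (36 * 2 ^ 8 * C), fun β hβ L D hDL => ?_⟩
  rcases lt_or_ge D 2 with hD2 | hD2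
  · refine le_trans ?_ (le_max_left _ _)
    have hcorr := WilsonBlockHeatBath.abs_latticeConnectedCorr_le_two_mul r β (2 * L + 1)
      (A := r.curvature.F) (B := fun V => r.curvature.F (cfgReflect V)) hCP (fun V => hCP _) D
    have hD : (D : ℝ) ^ 8 ≤ 1 := pow_le_one₀ (Nat.cast_nonneg _) (by exact_mod_cast (by omega : D ≤ 1))
    have hCC : 0 ≤ 2 * (CP * CP) := by nlinarith
    calc (D : ℝ) ^ 8 * |latticeConnectedCorr r.ρ β (2 * L + 1) r.curvature.F
          (fun V => r.curvature.F (cfgReflect V)) D|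
        ≤ 1 * (2 * (CP * CP)) := mul_le_mul hD hcorr (abs_nonneg _) zero_le_one
      _ = 2 * (CP * CP) := one_mul _
  · exact (pow_mul_abs_mirrorIn_le r (h β L hβ) hD2 hDL).trans (le_max_right _ _)

/-- **(A_out) from an all-volume pair ceiling at weak coupling**: the same for
`FixedAspectSplit.MirrorBoundOut r` (the registered stub `stub_mirrorBoundOut`). [cite: OsterwalderSeiler1978, §2] -/
theorem mirrorBoundOut_of_pairCeiling
    (h : ∃ (β₁ C : ℝ), ∀ (β : ℝ) (L : ℕ), β₁ ≤ β → PairCeilingAt r β L C) :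
    FixedAspectSplit.MirrorBoundOut r := by
  obtain ⟨β₁, C, h⟩ := h
  obtain ⟨CP, hCP⟩ := r.curvature.bounded
  refine ⟨β₁, max (2 * (CP * CP)) (36 * 2 ^ 8 * C), fun β hβ L D hDL => ?_⟩
  rcases lt_or_ge D 2 with hD2 | hD2
  · refine le_trans ?_ (le_max_left _ _)
    have hcorr := WilsonBlockHeatBath.abs_latticeConnectedCorr_le_two_mul r β (2 * L + 1)
      (A := fun V => r.curvature.F (cfgReflect V)) (B := r.curvature.F) (fun V => hCP _) hCP D
    have hD : (D : ℝ) ^ 8 ≤ 1 := pow_le_one₀ (Nat.cast_nonneg _) (by exact_mod_cast (by omega : D ≤ 1))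
    have hCC : 0 ≤ 2 * (CP * CP) := by nlinarith
    calc (D : ℝ) ^ 8 * |latticeConnectedCorr r.ρ β (2 * L + 1) (fun V => r.curvature.F (cfgReflect V))
          r.curvature.F D|
        ≤ 1 * (2 * (CP * CP)) := mul_le_mul hD hcorr (abs_nonneg _) zero_le_one
      _ = 2 * (CP * CP) := one_mul _
  · exact (pow_mul_abs_mirrorOut_le r (h β L hβ) hD2 hDL).trans (le_max_right _ _)

end Stubs

/-! ## The femto part of both stubs from the sibling crux `FemtoCurvatureTwoPointC` -/

section Femto

/-- The Euclidean torus distance of two DISTINCT sites of the odd torus `2L+1` is positive. [folklore] -/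
theorem torusDist_pos (L : ℕ) {x y : Fin 4 → ZMod (2 * L + 1)} (hxy : x ≠ y) :
    0 < Real.sqrt (∑ k : Fin 4, (((x k - y k).valMinAbs : ℤ) : ℝ) ^ 2) := by
  haveI : NeZero (2 * L + 1) := ⟨by omega⟩
  obtain ⟨k, hk⟩ : ∃ k, x k ≠ y k := Function.ne_iff.1 hxy
  refine Real.sqrt_pos.2 (lt_of_lt_of_le ?_ (Finset.single_le_sum (f := fun k : Fin 4 =>
    (((x k - y k).valMinAbs : ℤ) : ℝ) ^ 2) (fun k _ => sq_nonneg _) (Finset.mem_univ k)))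
  have hne : (x k - y k).valMinAbs ≠ 0 := by
    rw [Ne, ZMod.valMinAbs_eq_zero]
    exact sub_ne_zero.2 hk
  have : ((x k - y k).valMinAbs : ℝ) ≠ 0 := by exact_mod_cast hne
  positivity

/-- The Euclidean torus distance on the odd torus `2L+1` is at most `2L+1`. [folklore] -/
theorem torusDist_le (L : ℕ) (x y : Fin 4 → ZMod (2 * L + 1)) :
    Real.sqrt (∑ k : Fin 4, (((x k - y k).valMinAbs : ℤ) : ℝ) ^ 2) ≤ (2 * L + 1 : ℕ) := by
  haveI : NeZero (2 * L + 1) := ⟨by omega⟩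
  have hk : ∀ k : Fin 4, (((x k - y k).valMinAbs : ℤ) : ℝ) ^ 2 ≤ (L : ℝ) ^ 2 := by
    intro k
    have h1 : ((x k - y k).valMinAbs).natAbs ≤ L := by
      have := ZMod.natAbs_valMinAbs_le (x k - y k)
      omega
    have h2 : |(((x k - y k).valMinAbs : ℤ) : ℝ)| ≤ L := by
      rw [← Int.cast_abs, Int.abs_eq_natAbs]
      exact_mod_cast h1
    calc (((x k - y k).valMinAbs : ℤ) : ℝ) ^ 2 = |(((x k - y k).valMinAbs : ℤ) : ℝ)| ^ 2 := (sq_abs _).symm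
      _ ≤ (L : ℝ) ^ 2 := pow_le_pow_left₀ (abs_nonneg _) h2 2
  have hsum : ∑ k : Fin 4, (((x k - y k).valMinAbs : ℤ) : ℝ) ^ 2 ≤ (2 * (L : ℝ)) ^ 2 :=
    calc ∑ k : Fin 4, (((x k - y k).valMinAbs : ℤ) : ℝ) ^ 2 ≤ ∑ _k : Fin 4, (L : ℝ) ^ 2 :=
          Finset.sum_le_sum fun k _ => hk k
      _ = (2 * (L : ℝ)) ^ 2 := by simp [Finset.sum_const, Finset.card_univ]; ring
  calc Real.sqrt (∑ k : Fin 4, (((x k - y k).valMinAbs : ℤ) : ℝ) ^ 2)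
      ≤ Real.sqrt ((2 * (L : ℝ)) ^ 2) := Real.sqrt_le_sqrt hsum
    _ = 2 * L := Real.sqrt_sq (by positivity)
    _ ≤ (2 * L + 1 : ℕ) := by push_cast; linarith

/-- **The femto part of both mirror stubs follows from the sibling crux `FemtoCurvatureTwoPointC`
(stmt-QuantumFields-16204).** `FemtoCurvatureTwoPointC.CruxCAt r` — the body of that crux at `(G, r)` —
provides a unit map `a(β) → 0`, a femto radius `ℓ₀ > 0`, `β₁` and `K` such that BOTH canonical mirror ceilings
hold for all `β ≥ β₁`, all tori `2L+1` with `(2L+1)·a(β) ≤ ℓ₀` (the femto tori of the sibling), all `D ≤ L`.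
Its clause 3 (all-pairs ceiling `|cov|·dist⁸ ≤ C·Γ ≤ C`) is the pair ceiling of this file; the two-sided
axis window of the sibling is not used.  What (A_in)/(A_out) assert BEYOND this is the same ceiling on tori
larger than the femto window. [cite: OsterwalderSeiler1978, §2] -/
theorem mirrorBounds_femto_of_cruxCAt (r : LatticeRep G) (h : FemtoCurvatureTwoPointC.CruxCAt r) :
    ∃ (a : ℝ → ℝ) (ℓ₀ β₁ K : ℝ), 0 < ℓ₀ ∧ (∀ β, 0 < a β) ∧ Tendsto a atTop (𝓝 0) ∧
      ∀ β : ℝ, β₁ ≤ β → ∀ (L D : ℕ), ((2 * L + 1 : ℕ) : ℝ) * a β ≤ ℓ₀ → D ≤ L →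
        (D : ℝ) ^ 8 * |latticeConnectedCorr r.ρ β (2 * L + 1) r.curvature.F
          (fun V => r.curvature.F (cfgReflect V)) D| ≤ K ∧
        (D : ℝ) ^ 8 * |latticeConnectedCorr r.ρ β (2 * L + 1)
          (fun V => r.curvature.F (cfgReflect V)) r.curvature.F D| ≤ K := by
  obtain ⟨a, -, Γ, β₀, ℓ₀, c, C, hℓ₀, -, hapos, hatend, hΓ, hall⟩ := h
  obtain ⟨CP, hCP⟩ := r.curvature.bounded
  -- the pair ceiling on every femto torus, with constant `max C 0`
  have hpair : ∀ (β : ℝ) (L : ℕ), β₀ ≤ β → ((2 * L + 1 : ℕ) : ℝ) * a β ≤ ℓ₀ →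
      PairCeilingAt r β L (max C 0) := by
    intro β L hβ hfem x y i j i' j' hxy hij hij'
    have h3 := (hall (2 * L + 1) β hβ hfem).2 x y i j i' j' hxy hij hij'
    have hdpos := torusDist_pos L hxy
    have hdle := torusDist_le L x y
    have hs1 : 0 < Real.sqrt (∑ k : Fin 4, (((x k - y k).valMinAbs : ℤ) : ℝ) ^ 2) * a β :=
      mul_pos hdpos (hapos β)
    have hs2 : Real.sqrt (∑ k : Fin 4, (((x k - y k).valMinAbs : ℤ) : ℝ) ^ 2) * a β ≤ ℓ₀ :=
      (mul_le_mul_of_nonneg_right hdle (hapos β).le).trans hfem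
    have hΓ1 := (hΓ _ hs1 hs2).2
    have hΓ0 := (hΓ _ hs1 hs2).1
    refine h3.trans ?_
    calc C * Γ (Real.sqrt (∑ k : Fin 4, (((x k - y k).valMinAbs : ℤ) : ℝ) ^ 2) * a β)
        ≤ max C 0 * Γ (Real.sqrt (∑ k : Fin 4, (((x k - y k).valMinAbs : ℤ) : ℝ) ^ 2) * a β) :=
          mul_le_mul_of_nonneg_right (le_max_left _ _) hΓ0.le
      _ ≤ max C 0 * 1 := mul_le_mul_of_nonneg_left hΓ1 (le_max_right _ _)
      _ = max C 0 := mul_one _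
  refine ⟨a, ℓ₀, β₀, max (2 * (CP * CP)) (36 * 2 ^ 8 * max C 0), hℓ₀, hapos, hatend,
    fun β hβ L D hfem hDL => ?_⟩
  rcases lt_or_ge D 2 with hD2 | hD2
  · have hD : (D : ℝ) ^ 8 ≤ 1 := pow_le_one₀ (Nat.cast_nonneg _) (by exact_mod_cast (by omega : D ≤ 1))
    have hCC : 0 ≤ 2 * (CP * CP) := by nlinarith
    constructor
    · refine le_trans ?_ (le_max_left _ _)
      have hcorr := WilsonBlockHeatBath.abs_latticeConnectedCorr_le_two_mul r β (2 * L + 1)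
        (A := r.curvature.F) (B := fun V => r.curvature.F (cfgReflect V)) hCP (fun V => hCP _) D
      calc (D : ℝ) ^ 8 * |latticeConnectedCorr r.ρ β (2 * L + 1) r.curvature.F
            (fun V => r.curvature.F (cfgReflect V)) D|
          ≤ 1 * (2 * (CP * CP)) := mul_le_mul hD hcorr (abs_nonneg _) zero_le_one
        _ = 2 * (CP * CP) := one_mul _
    · refine le_trans ?_ (le_max_left _ _)
      have hcorr := WilsonBlockHeatBath.abs_latticeConnectedCorr_le_two_mul r β (2 * L + 1)
        (A := fun V => r.curvature.F (cfgReflect V)) (B := r.curvature.F) (fun V => hCP _) hCP D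
      calc (D : ℝ) ^ 8 * |latticeConnectedCorr r.ρ β (2 * L + 1) (fun V => r.curvature.F (cfgReflect V))
            r.curvature.F D|
          ≤ 1 * (2 * (CP * CP)) := mul_le_mul hD hcorr (abs_nonneg _) zero_le_one
        _ = 2 * (CP * CP) := one_mul _
  · exact ⟨(pow_mul_abs_mirrorIn_le r (hpair β L hβ hfem) hD2 hDL).trans (le_max_right _ _),
      (pow_mul_abs_mirrorOut_le r (hpair β L hβ hfem) hD2 hDL).trans (le_max_right _ _)⟩

/-- The same from the sibling crux ITSELF (all `(G, r)` at once): `FemtoCurvatureTwoPointC` ⇒ the femto part of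
both mirror stubs under the crux's prefix. [cite: OsterwalderSeiler1978, §2] -/
theorem mirrorBounds_femto_of_femtoCurvatureTwoPointC
    (h : Summit.QuantumFields.YangMills.Theses.LangevinControlUV.FemtoCurvatureTwoPointC) :
    ∀ (G : Type) [Group G] [TopologicalSpace G] [IsTopologicalGroup G] [CompactSpace G],
      IsCompactSimpleLieGroup G → letI : MeasurableSpace G := borel G
      haveI : BorelSpace G := ⟨rfl⟩
      ∀ (r : LatticeRep G),
    ∃ (a : ℝ → ℝ) (ℓ₀ β₁ K : ℝ), 0 < ℓ₀ ∧ (∀ β, 0 < a β) ∧ Tendsto a atTop (𝓝 0) ∧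
      ∀ β : ℝ, β₁ ≤ β → ∀ (L D : ℕ), ((2 * L + 1 : ℕ) : ℝ) * a β ≤ ℓ₀ → D ≤ L →
        (D : ℝ) ^ 8 * |latticeConnectedCorr r.ρ β (2 * L + 1) r.curvature.F
          (fun V => r.curvature.F (cfgReflect V)) D| ≤ K ∧
        (D : ℝ) ^ 8 * |latticeConnectedCorr r.ρ β (2 * L + 1)
          (fun V => r.curvature.F (cfgReflect V)) r.curvature.F D| ≤ K := by
  intro G _ _ _ _ hG
  letI : MeasurableSpace G := borel G
  haveI : BorelSpace G := ⟨rfl⟩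
  intro r
  exact mirrorBounds_femto_of_cruxCAt r ((FemtoCurvatureTwoPointC.femtoCurvatureTwoPointC_iff.1 h) G hG r)

end Femto

end Summit.QuantumFields.YangMills.Theorems.TunedSequenceExists.PairCeiling

end
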